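import Summits.CriticalPhenomena.Ising3D.Control2DReadoutWindow
import Summits.CriticalPhenomena.Ising3D.Control2DL19BoxXData146
import Summits.CriticalPhenomena.Ising3D.Control2DL19BoxXRegion
import Mathlib.Tactic.NormNum
import Mathlib.Tactic.Linarith
import HarnessLib

/-!
# Readout certificate B19 over a WINDOW: `f(4.06) < f(Δ)` for EVERY `Δ ∈ [2.0625, 4.03]` — the near-zero at `4.06 ± 0.03` is the
least value of the scalar-channel action over the whole window `[2.0625, 4.06 + 0.03]` (cell `pub-ising3x`, seat controls-1 gen 29;
KERNEL, certificate kind "readout", continuum form — CONTROL-ONLY)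

HONEST FRAMING: lottery ticket; floor = tightest certified 3D Ising CFT bounds; no exact-solution
claim without a proof. CONTROL-ONLY (`d = 2`, `Δ_σ = 1/8`); a statement about one of our INSTRUMENTS (the kernel-certified Λ = 19
lower-edge box functional `wtboxX`: RB-7 `j141725` (Λ = 19, E₀ = 48); box `[197/200, 99/100]`), not about a CFT; nothing about `d = 3`.

`Control2DReadoutB19.dip0_B19` samples `f(Δ) = φ[F^{1/8}_-[g_{Δ,0}]]` at `{4, 4.03, 4.06, 4.06+0.03}`. Here `f(4.06) < f(Δ)` is
certified for the CONTINUUM `Δ ∈ [33/16, 403 / 100]` by three Bernstein cells of the window polynomial (`Control2DReadoutWindow.windowCheck`: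
cell polynomial `phatboxXs0 = cellPolyZ wtboxX slL19 19 0 79` of the landed replay, digit cut `10^563` as in its landed cells, readout truncation
`N = 160`, region threshold `E₀ = 48`). Below `Δ = 2.0625` the action falls to its BINDING zero at the gap edge `Δ = 2` (a boundary zero
of the certificate: `f(2)/f(4.06) ≈ 0.02`), so the window starts just above it. With `dip0_B19` (`f(4.06) < f(4.06 + 0.03)`): over
`[2.0625, 4.06 + 0.03]` the least value is attained only inside `(4.03, 4.06 + 0.03)` — the instrument's first excited near-zero sits at
`δ₀(19) = 0.06 ± 0.03` above `T T̄ = 4` with NO lower excursion anywhere in `[2.0625, 4.03]`. Zero grant compute. No facts, standard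
axioms only. [cite: RattazziEtAl2008, §5.5]
-/

namespace Summit.CriticalPhenomena.Ising3D.Control2D

open Set
open Literature.MathematicalPhysics.QuantumFieldTheory.ConformalBootstrap3D

set_option maxHeartbeats 0 in
set_option maxRecDepth 200000 in
/-- Window cell 1: `y ∈ [33/32, 51/32]` (`Δ ∈ [2.0625, 3.1875]`). [folklore] -/
theorem windowCheck_B19_c1 : windowCheck wtboxX slL19 19 79 563 160 48 (203 / 50) 32 33 18 phatboxXs0 = true := by
  decide +kernel

set_option maxHeartbeats 0 in
set_option maxRecDepth 200000 in
/-- Window cell 2: `y ∈ [102/64, 121/64]` (`Δ ∈ [3.1875, 3.78125]`). [folklore] -/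
theorem windowCheck_B19_c2 : windowCheck wtboxX slL19 19 79 563 160 48 (203 / 50) 64 102 19 phatboxXs0 = true := by
  decide +kernel

set_option maxHeartbeats 0 in
set_option maxRecDepth 200000 in
/-- Window cell 3: `y ∈ [3025/1600, 3224/1600]` (`Δ ∈ [3.78125, 4.03]`). [folklore] -/
theorem windowCheck_B19_c3 : windowCheck wtboxX slL19 19 79 563 160 48 (203 / 50) 1600 3025 199 phatboxXs0 = true := by
  decide +kernel

set_option maxRecDepth 8192 in
/-- **B19 window readout, kernel-complete**: for `φ = taylorFunctional2D (1/2) slL19 wtboxX` (`Δ_σ = 1/8`, scalar channel) and EVERY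
`Δ ∈ [33/16, 403 / 100]`: `f(203 / 50) < f(Δ)`. CONTROL-ONLY (d = 2). [cite: RattazziEtAl2008, §5.5] -/
theorem window_B19 (Δ : ℝ) (h1 : (33 : ℝ) / 16 ≤ Δ) (h2 : Δ ≤ 403 / 100) :
    taylorFunctional2D (1 / 2) slL19.toFinset (fun p => (wtboxX p : ℝ)) (crossF (1 / 8) (-1) (globalBlock (203 / 50) 0)) <
      taylorFunctional2D (1 / 2) slL19.toFinset (fun p => (wtboxX p : ℝ)) (crossF (1 / 8) (-1) (globalBlock Δ 0)) := by
  have hR := (region_of_kernelCertAuto wtboxX slL19_nodup slL19_deg 19 20 (by norm_num) (by norm_num) PregboxX_eq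
      (by decide +kernel) QhatboxX_eq _ cregboxX_n0 cregJboxX (by decide) cregJboxX_ok)
  have em : (((203 / 50 : ℚ)) : ℝ) = 203 / 50 := by norm_num
  rcases le_total Δ (51 / 16) with hA | hA
  · have h := window_lt_of_windowCheck wtboxX slL19_nodup slL19_deg phatboxXs0_eq
      (fun b J hb hE => hR b J hb (by exact_mod_cast hE)) windowCheck_B19_c1 (Δ := Δ)
      (by push_cast; linarith) (by push_cast; linarith)
    rwa [em] at h
  rcases le_total Δ (121 / 32) with hB | hB
  · have h := window_lt_of_windowCheck wtboxX slL19_nodup slL19_deg phatboxXs0_eq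
      (fun b J hb hE => hR b J hb (by exact_mod_cast hE)) windowCheck_B19_c2 (Δ := Δ)
      (by push_cast; linarith) (by push_cast; linarith)
    rwa [em] at h
  · have h := window_lt_of_windowCheck wtboxX slL19_nodup slL19_deg phatboxXs0_eq
      (fun b J hb hE => hR b J hb (by exact_mod_cast hE)) windowCheck_B19_c3 (Δ := Δ)
      (by push_cast; linarith) (by push_cast; linarith)
    rwa [em] at h

end Summit.CriticalPhenomena.Ising3D.Control2D
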